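import Literature.NumberTheory.GaloisRepresentations.ContinuousCohomologyVanishing
import Literature.NumberTheory.GaloisRepresentations.GaloisCohomology
import Literature.NumberTheory.GaloisRepresentations.CoinducedModule
import Mathlib.Topology.Algebra.Group.Basic
import HarnessLib

/-!
# Continuous cochains of a compact group with discrete coefficients

For a compact topological group `Γ` and a *discrete `Γ`-module* `M` (a jointly continuous
linear action on a discrete abelian group, `ContinuousRep Γ A M` with `[DiscreteTopology M]`;
Serre I §2.1, Shatz II §1), the terms `Rₙ(M) = C(Γ, C(Γ, … C(Γ, M)))` of Mathlib's standard
resolution (`TopRep.resolutionX`) are again discrete `Γ`-modules: they carry the discrete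
topology (`discreteTopology_resolutionX`, from `discreteTopology_continuousMap` of
`CoinducedModule.lean`) and every stabiliser is open
(`stabilizer_resolutionX_mem_nhds_one`), because a continuous map from a compact group to a
discrete space takes finitely many values and is uniformly locally constant
(`exists_nhds_one_apply_mul_eq`, from Mathlib's `compact_open_separated_mul_left`).

Consequences proved here (the cochain-level content of Shatz II §1 Prop. 2 "the functor
`Cⁿ(G, -)` is exact" and Prop. 3, for Mathlib's homogeneous model):

* `cochainsHom_injective`, `cochainsHom_exact_mid`, `cochainsHom_surjective`: a short exact
  sequence `0 → M₁ → M₂ → M₃ → 0` of discrete `Γ`-modules gives a **degreewise short exact**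
  sequence of complexes of homogeneous cochains (surjectivity on invariant cochains uses the
  description of `C(Γ, Rₙ)^Γ` by the value at `1` and the continuity of orbit maps of `Rₙ`).
* The discrete `Γ`-modules entering dimension shifting: the coinduced module
  `ContinuousRep.coind ρ` on `C(Γ, M)` (Mathlib's `coind₁`, jointly continuous for compact `Γ`),
  quotients `ContinuousRep.quotient` by stable submodules, and for a normal subgroup `N` the
  invariants `M^N` as a discrete `Γ ⧸ N`-module (`ContinuousRep.quotientInvariants`, Serre I
  §2.6), with the induced maps.

## References

* S. S. Shatz, *Profinite groups, arithmetic, and geometry*, Ann. of Math. Studies 67 (1972),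
  Ch. II §1 (discrete modules, Prop. 2, Prop. 3), §2 (Prop. 4: induced modules are discrete
  modules). [Shatz1972]
* J.-P. Serre, *Cohomologie galoisienne*, 5e éd., Springer LNM 5 (1994; English translation
  *Galois Cohomology*, 1997), I §2.1, §2.2, §2.6. [SerreGaloisCohomology1997]
-/

noncomputable section

open CategoryTheory Limits Topology
open scoped Pointwise

universe u v w

namespace Literature.NumberTheory.GaloisRepresentations

/-! ### Continuous maps from compact spaces / groups to discrete spaces -/

section CompactDiscrete

variable {X : Type*} [TopologicalSpace X] [CompactSpace X] {Y : Type*} [TopologicalSpace Y]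
  [DiscreteTopology Y]

/-- A continuous map from a compact space to a discrete space has finite range. [folklore] -/
theorem finite_range_of_compact_discrete (f : C(X, Y)) : (Set.range f).Finite :=
  (isCompact_range f.continuous).finite_of_discrete

/-- For `X` compact and `Y` discrete, the compact-open topology on `C(X, Y)` is discrete
(`discreteTopology_continuousMap`, `CoinducedModule.lean`), registered as an instance for the
iterated function spaces of the standard resolution. [folklore] -/
instance instDiscreteTopologyContinuousMapOfCompact : DiscreteTopology C(X, Y) :=
  discreteTopology_continuousMap X Y

end CompactDiscrete

section CompactGroupDiscrete

variable {Γ : Type*} [Group Γ] [TopologicalSpace Γ] [IsTopologicalGroup Γ] [CompactSpace Γ]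
  {Y : Type*} [TopologicalSpace Y] [DiscreteTopology Y]

/-- **Uniform local constancy**: a continuous map `w` from a compact group to a discrete space
satisfies `w (v * x) = w x` for all `x` and all `v` in some neighbourhood of `1` (apply Mathlib's
`compact_open_separated_mul_left` to the finitely many compact open fibres of `w`). [folklore] -/
theorem exists_nhds_one_apply_mul_eq (w : C(Γ, Y)) :
    ∃ V ∈ 𝓝 (1 : Γ), ∀ v ∈ V, ∀ x : Γ, w (v * x) = w x := by
  have hfin := finite_range_of_compact_discrete w
  have hV : ∀ y : Y, ∃ V ∈ 𝓝 (1 : Γ), V * (w ⁻¹' {y}) ⊆ w ⁻¹' {y} := fun y =>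
    compact_open_separated_mul_left ((isClosed_discrete _).preimage w.continuous).isCompact
      ((isOpen_discrete _).preimage w.continuous) subset_rfl
  choose V hV1 hV2 using hV
  refine ⟨⋂ y ∈ Set.range w, V y, (Filter.biInter_mem hfin).2 fun y _ => hV1 y, fun v hv x => ?_⟩
  have hvx : v * x ∈ w ⁻¹' {w x} :=
    hV2 (w x) (Set.mul_mem_mul (Set.mem_iInter₂.1 hv (w x) ⟨x, rfl⟩) (Set.mem_preimage.2 rfl))
  exact hvx

end CompactGroupDiscrete

/-! ### The standard resolution of a discrete module over a compact group -/

section Resolution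

open _root_.TopRep _root_.ContRepresentation

variable {A : Type*} [CommRing A] [TopologicalSpace A]
variable {Γ : Type u} [Group Γ] [TopologicalSpace Γ] [IsTopologicalGroup Γ] [CompactSpace Γ]
variable {M : Type u} [AddCommGroup M] [Module A M] [TopologicalSpace M] [DiscreteTopology M]
  [ContinuousSMul A M]

variable (ρ : ContinuousRep Γ A M)

/-- The terms `Rₙ(M) = C(Γ, … C(Γ, M))` of the standard resolution of a discrete module over a
compact group are discrete. [folklore] -/
theorem discreteTopology_resolutionX : ∀ n : ℕ, DiscreteTopology (resolutionX ρ.toTopRep n)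
  | 0 => inferInstanceAs (DiscreteTopology M)
  | n + 1 => by
    haveI := discreteTopology_resolutionX n
    exact instDiscreteTopologyContinuousMapOfCompact

attribute [local instance] discreteTopology_resolutionX

/-- Every stabiliser of the `Γ`-action on `Rₙ(M)` is a neighbourhood of `1`, i.e. `Rₙ(M)` is a
discrete `Γ`-module (Shatz II §2 Prop. 4: induced modules of discrete modules are discrete
modules; induction on `n` using uniform local constancy). [cite: Shatz1972, Ch. II §2 Prop. 4] -/
theorem stabilizer_resolutionX_mem_nhds_one :
    ∀ (n : ℕ) (w : resolutionX ρ.toTopRep n),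
      {t : Γ | (resolutionX ρ.toTopRep n).ρ t w = w} ∈ 𝓝 (1 : Γ)
  | 0, w => ρ.setOf_apply_eq_mem_nhds_one w
  | n + 1, w => by
    obtain ⟨V, hV, hVw⟩ := exists_nhds_one_apply_mul_eq (w : C(Γ, resolutionX ρ.toTopRep n))
    have hfin := finite_range_of_compact_discrete (w : C(Γ, resolutionX ρ.toTopRep n))
    have hS : (V ∩ ⋂ r ∈ Set.range (w : C(Γ, resolutionX ρ.toTopRep n)),
        {t : Γ | (resolutionX ρ.toTopRep n).ρ t r = r}) ∈ 𝓝 (1 : Γ) :=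
      Filter.inter_mem hV ((Filter.biInter_mem hfin).2 fun r _ =>
        stabilizer_resolutionX_mem_nhds_one n r)
    -- the stabiliser is a subgroup containing a neighbourhood of `1`
    have hsub : V⁻¹ ∩ (⋂ r ∈ Set.range (w : C(Γ, resolutionX ρ.toTopRep n)),
        {t : Γ | (resolutionX ρ.toTopRep n).ρ t r = r}) ⊆
        {t : Γ | (resolutionX ρ.toTopRep (n + 1)).ρ t w = w} := by
      rintro t ⟨htV, htS⟩
      ext x : 1
      rw [resolutionX_succ_ρ_apply]
      have h1 : (w : C(Γ, resolutionX ρ.toTopRep n)) (t⁻¹ * x) = w x := hVw t⁻¹ htV x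
      rw [h1]
      exact Set.mem_iInter₂.1 htS (w x) ⟨x, rfl⟩
    exact Filter.mem_of_superset (Filter.inter_mem (inv_mem_nhds_one Γ hV |> fun h => by
      simpa using h) ((Filter.biInter_mem hfin).2 fun r _ =>
        stabilizer_resolutionX_mem_nhds_one n r)) hsub

/-- The terms of the standard resolution of a discrete `Γ`-module over a compact group, as
discrete `Γ`-modules (jointly continuous action; `ContinuousRep.ofStabilizerMemNhdsOne`).
[folklore] -/
def resolutionRep (n : ℕ) : ContinuousRep Γ A (resolutionX ρ.toTopRep n) :=
  ContinuousRep.ofStabilizerMemNhdsOne (resolutionX ρ.toTopRep n).ρ.toRepresentation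
    (stabilizer_resolutionX_mem_nhds_one ρ n)

/-- Unfolding `resolutionRep`. [folklore] -/
@[simp] theorem resolutionRep_apply_apply (n : ℕ) (t : Γ) (w : resolutionX ρ.toTopRep n) :
    resolutionRep ρ n t w = (resolutionX ρ.toTopRep n).ρ t w := rfl

/-- Orbit maps `t ↦ t • w` of the terms of the standard resolution of a discrete module over a
compact group are continuous (i.e. locally constant). [folklore] -/
theorem continuous_resolutionX_ρ_apply (n : ℕ) (w : resolutionX ρ.toTopRep n) :
    Continuous fun t : Γ => (resolutionX ρ.toTopRep n).ρ t w :=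
  (resolutionRep ρ n).continuous_apply_left w

/-- The invariant homogeneous cochain with prescribed value at `1`: `t ↦ t • w` is a
`Γ`-invariant element of `C(Γ, Rₙ) = Rₙ₊₁` (the inverse of "evaluation at `1`",
`C(Γ, Rₙ)^Γ ≅ Rₙ`). [folklore] -/
def orbitCochain (n : ℕ) (w : resolutionX ρ.toTopRep n) :
    (resolutionX ρ.toTopRep (n + 1)).ρ.invariants :=
  ⟨⟨fun t => (resolutionX ρ.toTopRep n).ρ t w, continuous_resolutionX_ρ_apply ρ n w⟩,
    (mem_invariants _).2 fun s => by
      ext t : 1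
      rw [resolutionX_succ_ρ_apply]
      change (resolutionX ρ.toTopRep n).ρ s ((resolutionX ρ.toTopRep n).ρ (s⁻¹ * t) w) =
        (resolutionX ρ.toTopRep n).ρ t w
      rw [← ContinuousLinearMap.comp_apply, ← ContinuousLinearMap.mul_def, ← map_mul,
        mul_inv_cancel_left]⟩

/-- `orbitCochain n w t = t • w`. [folklore] -/
@[simp] theorem orbitCochain_coe_apply (n : ℕ) (w : resolutionX ρ.toTopRep n) (t : Γ) :
    ((orbitCochain ρ n w).1 : C(Γ, resolutionX ρ.toTopRep n)) t =
      (resolutionX ρ.toTopRep n).ρ t w := rfl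

/-- An invariant element of `C(Γ, Rₙ)` is the orbit cochain of its value at `1`. [folklore] -/
theorem eq_orbitCochain (n : ℕ) (σ : (resolutionX ρ.toTopRep (n + 1)).ρ.invariants) :
    σ = orbitCochain ρ n ((σ.1 : C(Γ, resolutionX ρ.toTopRep n)) 1) := by
  apply Subtype.ext
  ext t : 1
  rw [orbitCochain_coe_apply]
  have h := congr($((mem_invariants _).1 σ.2 t) t)
  rw [resolutionX_succ_ρ_apply, inv_mul_cancel] at h
  exact h.symm

end Resolution

/-! ### Degreewise exactness of homogeneous cochains for discrete modules -/

section Exactness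

open _root_.TopRep _root_.ContRepresentation

variable {A : Type*} [CommRing A] [TopologicalSpace A]
variable {Γ : Type u} [Group Γ] [TopologicalSpace Γ] [IsTopologicalGroup Γ] [CompactSpace Γ]
variable {M₁ : Type u} [AddCommGroup M₁] [Module A M₁] [TopologicalSpace M₁] [DiscreteTopology M₁]
  [ContinuousSMul A M₁]
variable {M₂ : Type u} [AddCommGroup M₂] [Module A M₂] [TopologicalSpace M₂] [DiscreteTopology M₂]
  [ContinuousSMul A M₂]
variable {M₃ : Type u} [AddCommGroup M₃] [Module A M₃] [TopologicalSpace M₃] [DiscreteTopology M₃]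
  [ContinuousSMul A M₃]
variable {ρ₁ : ContinuousRep Γ A M₁} {ρ₂ : ContinuousRep Γ A M₂} {ρ₃ : ContinuousRep Γ A M₃}

attribute [local instance] discreteTopology_resolutionX

omit [CompactSpace Γ] in
/-- `resolutionHom f` is injective in every degree if `f` is. [folklore] -/
theorem resolutionHom_injective (f : ρ₁.toTopRep ⟶ ρ₂.toTopRep) (hf : Function.Injective f.hom) :
    ∀ n : ℕ, Function.Injective (resolutionHom f n).hom
  | 0 => hf
  | n + 1 => fun F F' h => by
    ext x : 1
    exact resolutionHom_injective f hf n congr($h x)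

/-- Exactness in the middle degreewise: if `ker g = im f` on `M₂` then the same holds for
`resolutionHom` in every degree (discrete modules over a compact group: preimages can be chosen
continuously because all terms are discrete). [cite: Shatz1972, Ch. II §1 Prop. 2] -/
theorem resolutionHom_exact_mid (f : ρ₁.toTopRep ⟶ ρ₂.toTopRep) (g : ρ₂.toTopRep ⟶ ρ₃.toTopRep)
    (hfg : ∀ y : M₂, g.hom y = 0 → ∃ x, f.hom x = y) :
    ∀ (n : ℕ) (y : resolutionX ρ₂.toTopRep n), (resolutionHom g n).hom y = 0 →
      ∃ x, (resolutionHom f n).hom x = y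
  | 0, y, hy => hfg y hy
  | n + 1, y, hy => by
    have hpt : ∀ t : Γ, ∃ x, (resolutionHom f n).hom x = (y : C(Γ, resolutionX ρ₂.toTopRep n)) t :=
      fun t => resolutionHom_exact_mid f g hfg n _ congr($hy t)
    refine ⟨⟨fun t => Function.invFun (resolutionHom f n).hom
      ((y : C(Γ, resolutionX ρ₂.toTopRep n)) t),
      (continuous_of_discreteTopology (f := Function.invFun (resolutionHom f n).hom)).comp
        (y : C(Γ, resolutionX ρ₂.toTopRep n)).continuous⟩, ?_⟩
    ext t : 1
    exact Function.invFun_eq (hpt t)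

/-- `resolutionHom g` is surjective in every degree if `g` is (Shatz II §1 Prop. 2: `Cⁿ(G, -)`
is exact on discrete modules — sections of surjections of discrete spaces are continuous).
[cite: Shatz1972, Ch. II §1 Prop. 2] -/
theorem resolutionHom_surjective (g : ρ₂.toTopRep ⟶ ρ₃.toTopRep) (hg : Function.Surjective g.hom) :
    ∀ n : ℕ, Function.Surjective (resolutionHom g n).hom
  | 0 => hg
  | n + 1 => fun y =>
    ⟨⟨fun t => Function.surjInv (resolutionHom_surjective g hg n)
        ((y : C(Γ, resolutionX ρ₃.toTopRep n)) t),
      (continuous_of_discreteTopology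
        (f := Function.surjInv (resolutionHom_surjective g hg n))).comp
        (y : C(Γ, resolutionX ρ₃.toTopRep n)).continuous⟩, by
      ext t : 1
      exact Function.surjInv_eq (resolutionHom_surjective g hg n) _⟩

omit [CompactSpace Γ] in
/-- The map of complexes of homogeneous cochains induced by an injective map of modules is
injective in every degree. [folklore] -/
theorem cochainsHom_injective (f : ρ₁.toTopRep ⟶ ρ₂.toTopRep) (hf : Function.Injective f.hom)
    (i : ℕ) : Function.Injective ((cochainsHom f).f i) := fun _ _ h =>
  Subtype.ext (resolutionHom_injective f hf (i + 1) (congrArg Subtype.val h))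

/-- Degreewise exactness in the middle of the complexes of homogeneous cochains of a short exact
sequence of discrete modules over a compact group. [cite: Shatz1972, Ch. II §1 Prop. 2 and Prop. 3] -/
theorem cochainsHom_exact_mid (f : ρ₁.toTopRep ⟶ ρ₂.toTopRep) (g : ρ₂.toTopRep ⟶ ρ₃.toTopRep)
    (hf : Function.Injective f.hom) (hfg : ∀ y : M₂, g.hom y = 0 → ∃ x, f.hom x = y) (i : ℕ)
    (σ : (homogeneousCochains ρ₂.toTopRep).X i) (hσ : (cochainsHom g).f i σ = 0) :
    ∃ τ, (cochainsHom f).f i τ = σ := by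
  obtain ⟨x, hx⟩ := resolutionHom_exact_mid f g hfg (i + 1) σ.1 (congrArg Subtype.val hσ)
  refine ⟨⟨x, (mem_invariants _).2 fun t => resolutionHom_injective f hf (i + 1) ?_⟩,
    Subtype.ext hx⟩
  refine (TopRep.hom_comm_apply (resolutionHom f (i + 1)) t x).trans ?_
  rw [hx]
  exact (mem_invariants _).1 σ.2 t

/-- The map of complexes of homogeneous cochains induced by a surjection of discrete modules
over a compact group is surjective in every degree: an invariant cochain is the orbit cochain of
its value at `1`, which lifts. [cite: Shatz1972, Ch. II §1 Prop. 2 and Prop. 3] -/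
theorem cochainsHom_surjective (g : ρ₂.toTopRep ⟶ ρ₃.toTopRep) (hg : Function.Surjective g.hom)
    (i : ℕ) : Function.Surjective ((cochainsHom g).f i) := fun σ => by
  obtain ⟨w, hw⟩ := resolutionHom_surjective g hg i
    ((σ.1 : C(Γ, resolutionX ρ₃.toTopRep i)) 1)
  refine ⟨orbitCochain ρ₂ i w, ?_⟩
  rw [eq_orbitCochain ρ₃ i σ]
  apply Subtype.ext
  ext t : 1
  change (resolutionHom g i).hom ((resolutionX ρ₂.toTopRep i).ρ t w) =
    (resolutionX ρ₃.toTopRep i).ρ t ((σ.1 : C(Γ, resolutionX ρ₃.toTopRep i)) 1)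
  refine (TopRep.hom_comm_apply (resolutionHom g i) t w).trans ?_
  rw [hw]

end Exactness

/-! ### Short exact sequences of discrete modules and the long exact sequence pieces -/

section SES

open _root_.TopRep _root_.ContRepresentation _root_.ContinuousCohomology

variable {A : Type*} [CommRing A] [TopologicalSpace A]
variable {Γ : Type u} [Group Γ] [TopologicalSpace Γ] [IsTopologicalGroup Γ] [CompactSpace Γ]
variable {M₁ : Type u} [AddCommGroup M₁] [Module A M₁] [TopologicalSpace M₁] [DiscreteTopology M₁]
  [ContinuousSMul A M₁]
variable {M₂ : Type u} [AddCommGroup M₂] [Module A M₂] [TopologicalSpace M₂] [DiscreteTopology M₂]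
  [ContinuousSMul A M₂]
variable {M₃ : Type u} [AddCommGroup M₃] [Module A M₃] [TopologicalSpace M₃] [DiscreteTopology M₃]
  [ContinuousSMul A M₃]
variable {ρ₁ : ContinuousRep Γ A M₁} {ρ₂ : ContinuousRep Γ A M₂} {ρ₃ : ContinuousRep Γ A M₃}

set_option allowUnsafeReducibility true in
attribute [local reducible] CategoryTheory.Functor.mapHomologicalComplex

/-- A **short exact sequence** `0 → M₁ → M₂ → M₃ → 0` of discrete `Γ`-modules (morphisms of
the attached topological representations; exactness of the underlying abelian groups).
[cite: Shatz1972, Ch. II §1 (1)] -/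
structure IsSES (f : ρ₁.toTopRep ⟶ ρ₂.toTopRep) (g : ρ₂.toTopRep ⟶ ρ₃.toTopRep) : Prop where
  comp_eq_zero : f ≫ g = 0
  injective : Function.Injective f.hom
  exact_mid : ∀ y : M₂, g.hom y = 0 → ∃ x, f.hom x = y
  surjective : Function.Surjective g.hom

namespace IsSES

variable {f : ρ₁.toTopRep ⟶ ρ₂.toTopRep} {g : ρ₂.toTopRep ⟶ ρ₃.toTopRep}

/-- **Exactness of `Hⁿ⁺¹(M₂) → Hⁿ⁺¹(M₃) → Hⁿ⁺²(M₁)`** in vanishing form, for a short exact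
sequence of discrete modules over a compact group. [cite: Shatz1972, Ch. II §1 Prop. 3] -/
theorem subsingleton_X₃ (h : IsSES f g) (n : ℕ)
    (h₂ : Subsingleton (continuousCohomology (n + 1) ρ₂.toTopRep))
    (h₁ : Subsingleton (continuousCohomology (n + 2) ρ₁.toTopRep)) :
    Subsingleton (continuousCohomology (n + 1) ρ₃.toTopRep) :=
  subsingleton_homology_X₃ (cochainsHom f) (cochainsHom g)
    (cochainsHom_comp_apply_eq_zero f g h.comp_eq_zero) (cochainsHom_injective f h.injective)
    (cochainsHom_exact_mid f g h.injective h.exact_mid) (cochainsHom_surjective g h.surjective)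
    n h₂ h₁

/-- **Exactness of `Hⁿ⁺¹(M₃) → Hⁿ⁺²(M₁) → Hⁿ⁺²(M₂)`** in vanishing form (dimension shifting), for
a short exact sequence of discrete modules over a compact group.
[cite: Shatz1972, Ch. II §1 Prop. 3 and §2 Prop. 6] -/
theorem subsingleton_X₁ (h : IsSES f g) (n : ℕ)
    (h₃ : Subsingleton (continuousCohomology (n + 1) ρ₃.toTopRep))
    (h₂ : Subsingleton (continuousCohomology (n + 2) ρ₂.toTopRep)) :
    Subsingleton (continuousCohomology (n + 2) ρ₁.toTopRep) :=
  subsingleton_homology_X₁ (cochainsHom f) (cochainsHom g)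
    (cochainsHom_comp_apply_eq_zero f g h.comp_eq_zero) (cochainsHom_injective f h.injective)
    (cochainsHom_exact_mid f g h.injective h.exact_mid) (cochainsHom_surjective g h.surjective)
    n h₃ h₂

omit [CompactSpace Γ] in
/-- The homogeneous `0`-cocycle attached to a `Γ`-invariant element (the constant function;
Mathlib `ContinuousCohomology.mem_const_resol₀`). [folklore] -/
def zeroCochain (ρ : ContinuousRep Γ A M₁) (v : M₁) (hv : v ∈ ρ.toTopRep.ρ.invariants) :
    (homogeneousCochains ρ.toTopRep).X 0 :=
  ⟨ContinuousMap.const Γ v, mem_const_resol₀ ρ.toTopRep v hv⟩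

omit [CompactSpace Γ] in
/-- `zeroCochain v` is a cocycle. [folklore] -/
theorem d_zeroCochain (ρ : ContinuousRep Γ A M₁) (v : M₁) (hv : v ∈ ρ.toTopRep.ρ.invariants) :
    ((homogeneousCochains ρ.toTopRep).d 0 1).hom (zeroCochain ρ v hv) = 0 :=
  (cochains_d_zero_eq_zero_iff _ _).2 ⟨v, hv, rfl⟩

/-- **Exactness of `H⁰(M₂) → H⁰(M₃) → H¹(M₁)`**: if `H¹(Γ, M₁) = 0` then `M₂^Γ → M₃^Γ` is onto
(and `H⁰ = ` invariants, Shatz II §1 (6)). [cite: Shatz1972, Ch. II §1 Prop. 3 and (6)] -/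
theorem exists_invariant_lift (h : IsSES f g)
    (hL : Subsingleton (continuousCohomology 1 ρ₂.toTopRep))
    (hK : Subsingleton (continuousCohomology 1 ρ₁.toTopRep)) (v : M₃)
    (hv : v ∈ ρ₃.toTopRep.ρ.invariants) : ∃ w ∈ ρ₂.toTopRep.ρ.invariants, g.hom w = v := by
  have H := (subsingleton_homology_one_X₁_iff (cochainsHom f) (cochainsHom g)
    (cochainsHom_comp_apply_eq_zero f g h.comp_eq_zero) (cochainsHom_injective f h.injective)
    (cochainsHom_exact_mid f g h.injective h.exact_mid) (cochainsHom_surjective g h.surjective)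
    hL).1 hK
  obtain ⟨b, hb, hbc⟩ := H (zeroCochain ρ₃ v hv) (d_zeroCochain ρ₃ v hv)
  obtain ⟨w, hw, hbw⟩ := (cochains_d_zero_eq_zero_iff _ b).1 hb
  refine ⟨w, hw, ?_⟩
  have := congr(((($hbc : (homogeneousCochains ρ₃.toTopRep).X 0) : resolutionX ρ₃.toTopRep 1) :
    C(Γ, M₃)) 1)
  rw [cochainsHom_f_coe, resolutionHom_succ_hom_apply, hbw] at this
  exact this

/-- **`H¹(Γ, M₁) = 0` from `H¹(Γ, M₂) = 0` and surjectivity of `M₂^Γ → M₃^Γ`** (exactness of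
`H⁰(M₂) → H⁰(M₃) → H¹(M₁) → H¹(M₂)`). [cite: Shatz1972, Ch. II §1 Prop. 3 and (6)] -/
theorem subsingleton_one (h : IsSES f g)
    (hL : Subsingleton (continuousCohomology 1 ρ₂.toTopRep))
    (H : ∀ v ∈ ρ₃.toTopRep.ρ.invariants, ∃ w ∈ ρ₂.toTopRep.ρ.invariants, g.hom w = v) :
    Subsingleton (continuousCohomology 1 ρ₁.toTopRep) := by
  refine (subsingleton_homology_one_X₁_iff (cochainsHom f) (cochainsHom g)
    (cochainsHom_comp_apply_eq_zero f g h.comp_eq_zero) (cochainsHom_injective f h.injective)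
    (cochainsHom_exact_mid f g h.injective h.exact_mid) (cochainsHom_surjective g h.surjective)
    hL).2 fun c hc => ?_
  obtain ⟨v, hv, hcv⟩ := (cochains_d_zero_eq_zero_iff _ c).1 hc
  obtain ⟨w, hw, hwv⟩ := H v hv
  refine ⟨zeroCochain ρ₂ w hw, d_zeroCochain ρ₂ w hw, Subtype.ext ?_⟩
  rw [cochainsHom_f_coe, hcv]
  ext x
  rw [resolutionHom_succ_hom_apply]
  exact hwv

end IsSES

end SES

/-! ### Discrete modules entering dimension shifting -/

section Modules

open _root_.TopRep _root_.ContRepresentation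

variable {A : Type*} [CommRing A] [TopologicalSpace A]
variable {Γ : Type u} [Group Γ] [TopologicalSpace Γ] [IsTopologicalGroup Γ]
variable {M : Type u} [AddCommGroup M] [Module A M] [TopologicalSpace M] [DiscreteTopology M]
  [ContinuousSMul A M]
variable {M' : Type u} [AddCommGroup M'] [Module A M'] [TopologicalSpace M'] [DiscreteTopology M']
  [ContinuousSMul A M']

/-- A quotient of a discrete module is discrete. [folklore] -/
instance discreteTopology_submoduleQuotient (W : Submodule A M) : DiscreteTopology (M ⧸ W) := by
  rw [discreteTopology_iff_isOpen_singleton]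
  rintro ⟨m⟩
  have := W.isOpenMap_mkQ {m} (isOpen_discrete _)
  rwa [Set.image_singleton] at this

namespace ContinuousRep

/-- The **quotient** of a discrete `Γ`-module by a `Γ`-stable submodule, as a discrete
`Γ`-module (Mathlib `Representation.quotient`; the stabiliser of `m mod W` contains that of `m`).
[folklore] -/
def quotient (ρ : ContinuousRep Γ A M) (W : Submodule A M) (hW : ∀ g, W ≤ W.comap (ρ g)) :
    ContinuousRep Γ A (M ⧸ W) :=
  ContinuousRep.ofStabilizerMemNhdsOne (ρ.toRepresentation.quotient W hW) fun q => by
    induction q using Submodule.Quotient.induction_on with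
    | _ m =>
      refine Filter.mem_of_superset (ρ.setOf_apply_eq_mem_nhds_one m) fun g hg => ?_
      simp only [Set.mem_setOf_eq] at hg ⊢
      rw [Representation.quotient_apply]
      change Submodule.Quotient.mk (ρ g m) = Submodule.Quotient.mk m
      rw [hg]

omit [ContinuousSMul A M] in
/-- Unfolding `ContinuousRep.quotient` on classes. [folklore] -/
@[simp] theorem quotient_apply_mk (ρ : ContinuousRep Γ A M) (W : Submodule A M)
    (hW : ∀ g, W ≤ W.comap (ρ g)) (g : Γ) (m : M) :
    ρ.quotient W hW g (Submodule.Quotient.mk m) = Submodule.Quotient.mk (ρ g m) := rfl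

/-- The quotient map `M → M ⧸ W` as a morphism of topological representations. [folklore] -/
def mkQHom (ρ : ContinuousRep Γ A M) (W : Submodule A M) (hW : ∀ g, W ≤ W.comap (ρ g)) :
    ρ.toTopRep ⟶ (ρ.quotient W hW).toTopRep :=
  TopRep.ofHom ⟨⟨W.mkQ, continuous_of_discreteTopology⟩, fun g => by ext m; rfl⟩

/-- `mkQHom` is the quotient map on elements. [folklore] -/
@[simp] theorem mkQHom_hom_apply (ρ : ContinuousRep Γ A M) (W : Submodule A M)
    (hW : ∀ g, W ≤ W.comap (ρ g)) (m : M) :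
    (ρ.mkQHom W hW).hom m = Submodule.Quotient.mk m := rfl

variable [CompactSpace Γ]

/-- The **coinduced discrete module** `C(Γ, M)` of a discrete `Γ`-module over a compact group,
`(g • f)(x) = g • f(g⁻¹ x)` (Mathlib's `coind₁`, i.e. the term `R₁` of the standard resolution,
with its jointly continuous action; Shatz II §2 Prop. 4 `π_{*1→G}`, in the twisted model).
[cite: Shatz1972, Ch. II §2 Prop. 4] -/
def coind (ρ : ContinuousRep Γ A M) : ContinuousRep Γ A C(Γ, M) := resolutionRep ρ 1

/-- Unfolding `ContinuousRep.coind`: `(g • f)(x) = g • f (g⁻¹ x)`. [folklore] -/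
@[simp] theorem coind_apply_apply (ρ : ContinuousRep Γ A M) (g : Γ) (f : C(Γ, M)) (x : Γ) :
    ρ.coind g f x = ρ g (f (g⁻¹ * x)) := rfl

/-- `ρ.coind` is Mathlib's `coind₁` as a topological representation. [folklore] -/
def coindIso (ρ : ContinuousRep Γ A M) : ρ.coind.toTopRep ≅ coind₁ ρ.toTopRep :=
  topRepIsoOfEquiv (ContinuousLinearEquiv.refl A _) fun _ _ => rfl

/-- The embedding `M → C(Γ, M)`, `m ↦ (x ↦ m)` (constant functions), as a morphism of
topological representations `ρ ⟶ ρ.coind` (Mathlib `coind₁ι`; Shatz II §2 Cor. 2 `ε_A` in the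
twisted model). [cite: Shatz1972, Ch. II §2 Prop. 4 Cor. 2] -/
def coindι (ρ : ContinuousRep Γ A M) : ρ.toTopRep ⟶ ρ.coind.toTopRep :=
  TopRep.ofHom ⟨ContinuousLinearMap.const A Γ, fun g => by
    ext m x
    change ρ g m = ρ g ((ContinuousMap.const Γ m) (g⁻¹ * x))
    rfl⟩

/-- `coindι` is the constant-function map on elements. [folklore] -/
@[simp] theorem coindι_hom_apply (ρ : ContinuousRep Γ A M) (m : M) :
    ρ.coindι.hom m = ContinuousMap.const Γ m := rfl

omit [IsTopologicalGroup Γ] [AddCommGroup M] [DiscreteTopology M] [CompactSpace Γ] in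
/-- `coindι` is injective (the group is nonempty). [folklore] -/
theorem const_injective : Function.Injective (ContinuousMap.const Γ : M → C(Γ, M)) :=
  fun _ _ h => congr($h 1)

/-- The image of `coindι`, a `Γ`-stable submodule of `C(Γ, M)`. [folklore] -/
def constSubmodule (ρ : ContinuousRep Γ A M) : Submodule A C(Γ, M) :=
  LinearMap.range (ρ.coindι.hom.toContinuousLinearMap.toLinearMap)

/-- Membership in `constSubmodule`. [folklore] -/
theorem mem_constSubmodule_iff (ρ : ContinuousRep Γ A M) (f : C(Γ, M)) :
    f ∈ ρ.constSubmodule ↔ ∃ m : M, ContinuousMap.const Γ m = f := Iff.rfl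

/-- The constant functions are stable under the action of `ρ.coind`. [folklore] -/
theorem constSubmodule_le_comap (ρ : ContinuousRep Γ A M) (g : Γ) :
    ρ.constSubmodule ≤ ρ.constSubmodule.comap (ρ.coind g) := by
  rintro _ ⟨m, rfl⟩
  refine ⟨ρ g m, ?_⟩
  ext x
  change ρ g m = ρ g ((ContinuousMap.const Γ m) (g⁻¹ * x))
  rfl

/-- The **dimension-shifting quotient** `Q = C(Γ, M) ⧸ M` of a discrete `Γ`-module over a
compact group, as a discrete `Γ`-module (Shatz II §2 Prop. 6: `coker ε_B`).
[cite: Shatz1972, Ch. II §2 Prop. 6] -/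
def coindQuot (ρ : ContinuousRep Γ A M) : ContinuousRep Γ A (C(Γ, M) ⧸ ρ.constSubmodule) :=
  ρ.coind.quotient ρ.constSubmodule ρ.constSubmodule_le_comap

/-- The quotient map `C(Γ, M) → Q`. [folklore] -/
def coindπ (ρ : ContinuousRep Γ A M) : ρ.coind.toTopRep ⟶ ρ.coindQuot.toTopRep :=
  ρ.coind.mkQHom ρ.constSubmodule ρ.constSubmodule_le_comap

/-- `coindι ≫ coindπ = 0`. [folklore] -/
theorem coindι_comp_coindπ (ρ : ContinuousRep Γ A M) : ρ.coindι ≫ ρ.coindπ = 0 := by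
  ext m
  change Submodule.Quotient.mk (ContinuousMap.const Γ m) = (0 : C(Γ, M) ⧸ ρ.constSubmodule)
  exact (Submodule.Quotient.mk_eq_zero _).2 ⟨m, rfl⟩

/-- Exactness of `M → C(Γ, M) → Q` at `C(Γ, M)`. [folklore] -/
theorem coind_exact_mid (ρ : ContinuousRep Γ A M) (f : C(Γ, M)) (hf : ρ.coindπ.hom f = 0) :
    ∃ m : M, ρ.coindι.hom m = f := by
  change Submodule.Quotient.mk f = (0 : C(Γ, M) ⧸ ρ.constSubmodule) at hf
  exact (Submodule.Quotient.mk_eq_zero _).1 hf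

/-- `coindπ` is surjective. [folklore] -/
theorem coindπ_surjective (ρ : ContinuousRep Γ A M) : Function.Surjective ρ.coindπ.hom :=
  Submodule.mkQ_surjective _

/-- `coindι` is injective. [folklore] -/
theorem coindι_injective (ρ : ContinuousRep Γ A M) : Function.Injective ρ.coindι.hom :=
  const_injective

end ContinuousRep

end Modules

/-! ### Invariants under a normal subgroup as a module over the quotient group -/

section QuotientGroup

open _root_.TopRep _root_.ContRepresentation

variable {A : Type*} [CommRing A] [TopologicalSpace A]
variable {Γ : Type u} [Group Γ] [TopologicalSpace Γ] [IsTopologicalGroup Γ]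
variable {M : Type u} [AddCommGroup M] [Module A M] [TopologicalSpace M] [DiscreteTopology M]
  [ContinuousSMul A M]
variable {M' : Type u} [AddCommGroup M'] [Module A M'] [TopologicalSpace M'] [DiscreteTopology M']
  [ContinuousSMul A M']

namespace ContinuousRep

variable (N : Subgroup Γ) [N.Normal]

/-- The submodule `M^N` of invariants of a normal subgroup `N` (Mathlib
`Representation.invariants` of the restriction). [folklore] -/
abbrev invariantsOf (ρ : ContinuousRep Γ A M) : Submodule A M :=
  Representation.invariants (ρ.toRepresentation.comp N.subtype)

omit [IsTopologicalGroup Γ] [DiscreteTopology M] [ContinuousSMul A M] [N.Normal] in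
/-- Membership in `M^N`. [folklore] -/
theorem mem_invariantsOf_iff (ρ : ContinuousRep Γ A M) (m : M) :
    m ∈ ρ.invariantsOf N ↔ ∀ n : N, ρ n m = m := Iff.rfl

/-- For a normal subgroup `N ⊴ Γ`, the invariants `M^N` of a discrete `Γ`-module as a discrete
module over the topological quotient group `Γ ⧸ N` (Mathlib `Representation.toInvariants`,
`Representation.ofQuotient`); continuity: the stabiliser of `w` in `Γ ⧸ N` is the image of its
open stabiliser in `Γ` under the open map `Γ → Γ ⧸ N` (Serre I §2.6: the `G/H`-module `A^H`).
This is the construction of `DiscreteGaloisModule.quotientInvariants` (`GaloisCohomology.lean`,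
the case `Γ = Γ_K`) for an arbitrary topological group. [cite: SerreGaloisCohomology1997, I §2.6] -/
def quotientInvariants (ρ : ContinuousRep Γ A M) :
    ContinuousRep (Γ ⧸ N) A (ρ.invariantsOf N) :=
  ContinuousRep.ofStabilizerMemNhdsOne
    (Representation.ofQuotient (ρ.toRepresentation.toInvariants N) N) fun w => by
      have h := (QuotientGroup.isOpenMap_coe (N := N)).image_mem_nhds
        ((ContinuousRep.subrepresentation ρ _
          (Representation.le_comap_invariants ρ.toRepresentation N)).setOf_apply_eq_mem_nhds_one
          w)
      refine Filter.mem_of_superset h ?_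
      rintro _ ⟨σ, hσ, rfl⟩
      exact hσ

omit [ContinuousSMul A M] in
/-- Unfolding `quotientInvariants` on classes of elements of `Γ`. [folklore] -/
@[simp] theorem quotientInvariants_apply_coe (ρ : ContinuousRep Γ A M) (σ : Γ)
    (w : ρ.invariantsOf N) :
    ((ρ.quotientInvariants N (σ : Γ ⧸ N) w : ρ.invariantsOf N) : M) = ρ σ w := rfl

variable {N}

/-- A morphism of discrete `Γ`-modules restricts to a morphism `M^N → M'^N` of discrete
`Γ ⧸ N`-modules. [folklore] -/
def invariantsHom {ρ : ContinuousRep Γ A M} {ρ' : ContinuousRep Γ A M'} (f : ρ.toTopRep ⟶ ρ'.toTopRep) :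
    (ρ.quotientInvariants N).toTopRep ⟶ (ρ'.quotientInvariants N).toTopRep :=
  TopRep.ofHom
    ⟨⟨(f.hom.toLinearMap.restrict (p := ρ.invariantsOf N) (q := ρ'.invariantsOf N) fun m hm n => by
        change ρ' (n : Γ) (f.hom m) = f.hom m
        have h1 : f.hom (ρ (n : Γ) m) = ρ' (n : Γ) (f.hom m) := TopRep.hom_comm_apply f (n : Γ) m
        rw [← h1]
        exact congrArg f.hom (hm n)),
      continuous_of_discreteTopology⟩, by
      rintro ⟨σ⟩
      ext ⟨m, hm⟩
      exact TopRep.hom_comm_apply f σ m⟩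

/-- `invariantsHom f` is `f` on elements. [folklore] -/
@[simp] theorem invariantsHom_hom_apply_coe {ρ : ContinuousRep Γ A M} {ρ' : ContinuousRep Γ A M'}
    (f : ρ.toTopRep ⟶ ρ'.toTopRep) (w : ρ.invariantsOf N) :
    (((invariantsHom (N := N) f).hom w : ρ'.invariantsOf N) : M') = f.hom w := rfl

end ContinuousRep

end QuotientGroup

end Literature.NumberTheory.GaloisRepresentations

end
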